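import Summits.Schanuel.Schanuel.Theorems.RootDecomp1KRunge06

/-!
# RootDecomp1KDescent — lens 1, generation 58, NODE 19 «DESCENT ON THE K-LINE» (Chevalley–Weil 2-descent to an étale double cover, then 2-adic Runge on the cover; RULE K-R49 (iii) payable clause; CLAIM L2723, PRICE L2727, K-R50) — part 1 (RootDecomp1KDescent01): §0–§4 (small facts, the curves dsP, the level equation, the Eisenstein form, THE DESCENT LEMMA)

(lens-1 g58 NODE 19 HOME kernel K = HOME/decomp-schanuel-lens-1/g58/Descent.lean 92ee3617…, 1568 l, 121 thm + 32 defs/structures (structure DescentCert, structure EisQ), imports tree …RootDecomp1KRunge06 ONLY = the port of node 18 (no Literature import, no fact def, no private, no set_option, no axiom / instance / sorry / native_decide); Probe / Ctrl0 / Ctrl (56 planted controls, ctrl_table19.txt) + NODE-g58.md + cert58.json/.txt + SHA256SUMS (34 files); CLAIM L2723, writer CHECK NOTE L2724/L2725 (certificate arithmetic reproduced at 13 values of λ), crit g10 EX-ANTE PRICE L2727 (ONE THEOREM ×1 for (A) engine + (B) the class DJ(3^j) + (C) territory JOINTLY iff CHECKLIST K-g58 (1)–(10); RULE K-R50 pre-announced;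 node-18 label erratum), census LIVENESS-v10 L2733 (keys k2 / desc2; DJ rows; of record L2735), NODE L2743, critic VERDICT L2746 (crit g10): CLEARED — THEOREM ×1 for (A) engine + (B) the class {DJ 3^j} + (C) territory JOINTLY under RULE K-R49 (iii) («an infinite class of K-R49-territory pairs made unconditional», currency LevelFinite — strictly stronger than the residual ThinFibreAt 2), checklist K-g58 (1)–(10) met, rung 0; labels of record: VARIANT of a KNOWN TOOL (Levin 2008 §3 Thm 6 «Coverings and Runge's method» [corpus:paper:arxiv-0805.1345 p.7]) · PROBLEM-RELATIVE NEW (first descent on the K-line; first members outside every Runge-certifiable class; first LevelFinite for a positive-genus non-uniformised member); RULE K-R50 FIXED (toolkit of record ∪= 2-DESCENT via ℚ-rational 2-torsion of the Jacobian — for k = 2 a factorisation of Δ_x = c₁² − 4c₀c₂ over ℚ, in particular the square type −4·A·B with A + B = c₂ — twists killed by congruences / supports, then any toolkit step upstairs, every further such member / family / presentation / cover degree 2^r / Eisenstein prime / the abstract Descent2At engine ×0-as-record; OPEN TERRITORY at m₀ = 2 := K-R49 territory ∧ Jac has NO ℚ-rational 2-torsion datum — for k = 2 certified by «Δ_x ℚ-irreducible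 of degree ≡ 2 (mod 4)»; standing witness W4 (census TM33); UNCONDITIONAL PART ∪= {DJ 3^j} at the currency LevelFinite); PORT GO exactly as census STAGING NOTE 9 L2744 (agreed by the lens L2745) with the edits (a) + (b) SANCTIONED. Port by census-1 gen 23 as `RootDecomp1KDescent01–06` (`--supports stmt-Schanuel-33364`; no census credit): 01 = §0 small facts, §1 the curves `dsP Q A = x²·Q(Y) + (2x+1)·A(Y)` (`dsC`, `bev_dsP`), §2 the level equation in integers, §3 the Eisenstein form of `F_Q` (`structure EisQ`) and the homogenised `Y⁶`-identity, §4 THE DESCENT LEMMA (`twist_mod_eight`, `twist_support`, `twist_kill`, `twist_le`, **`descent`**); 02 = §5 the 2-adic Runge step on the double cover (`exists_sign_small`, ultrametric bookkeeping in ℂ₂), §6 `structure DescentCert Q A` (integral data + identities only) and the integer `dsI`; 03 = §7 the lift of a level point to the cover read in ℂ₂ (‖I‖₂ ≤ (2/‖D‖₂)·2^{−3·N!} for one sign), §8 the norm `dsNu`, the archimedean size of `I`, the endgame (`endgame_ds`, cost 5 < 6 = 2μ); 04 = §9 THE ENGINE **`levelFinite_of_descentCert : DescentCert Q A → LevelFinite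 (dsP Q A)`** and `thinFibreAt_of_descentCert` (every m₀); 05 = §10 THE FAMILY `DJ λ` (`djQ = Y⁴+3Y³+3Y²+3`, `djA`, `DJ`), ONE certificate `djCert j` polynomial in λ = 3^j, **`levelFinite_DJ : ∀ j, LevelFinite (DJ (3^j))`**, **`thinFibreAt_DJ : ∀ j m₀, ThinFibreAt m₀ (DJ (3^j))`** HYPOTHESIS-FREE, `DJ_injective`, named members `DJ1` `DJ3` `DJ9`; 06 = §11 TERRITORY (section Territory) by tree names: `isEisensteinAt_djQ`, irreducibility of the top over ℚ, **`DJ_territory`**, the named members' territory. PORT EDITS: (a) 16 one-line docstrings quoting the signature on the undocumented decls (`dsC_two` / `dsC_one` / `dsC_zero` / `dsC_of_gt`, `natDegree_djA_le`, `natDegree_djT_le`, `natDegree_djF0_le` … `natDegree_djF3_le`, `levelFinite_DJ1/3/9`, `thinFibreAt_two_DJ1/3/9`); (b) PRIVATISATION ×5 of one-liners that the head dry-run flagged as near-duplicates of foreign / out-of-cone declarations — `odd_three_pow` (≡ a Crystal3D decl), `norm_intCast_le_one_ds` (≡ a BirchSwinnertonDyer decl; tree-private twins in Runge01 / LocalExponent01),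 `eight_dvd_sq_sub_one_ds` (≡ a HodgeConjecture decl), `isCoprime_num_den_ds` (≡ `Literature.NumberTheory.DiophantineApproximation.isCoprime_num_den`, not in the import cone), `odd_psNumer_ds` (≡ `RootDecomp1KCollarCell.odd_psNumer_two`, same summit but outside the cone — importing CollarCell02 would add 53 modules) — with file-local private copies re-emitted where a later part uses them (03: `norm_intCast_le_one_ds`, `odd_three_pow`; 04: `isCoprime_num_den_ds`, `odd_psNumer_ds`; 05: `odd_three_pow`); nothing else (no deletion, no replacement, no import added, no set_option; K's three `@[simp]` kept); provenance doc blocks + continuation headers = K's own open-lines; statements and proofs VERBATIM. Rung 0 — nothing here proves Schanuel, 33364, 33363, 31077 or ThinFibre 2; everything HYPOTHESIS-FREE.)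
-/

/-!
# RootDecomp1KDescent — lens 1, generation 58, NODE 19 «DESCENT ON THE K-LINE»

2-DESCENT (Chevalley–Weil) to an étale double cover, THEN 2-adic Runge on the cover, for the `x`-degree-2
curves `P = Q(Y)·x² + A(Y)·(2x + 1) = B(Y)·x² + A(Y)·(x + 1)²` (`B := Q − A`) on the levels `x = s_N = p_N/2^{N!}`.
The top `x`-coefficient `Q` is ℚ-IRREDUCIBLE of FULL degree (`deg_Y P = deg Q = 4 = 2·xdeg P`), so `P` carries ONE
Galois orbit of places over `x = ∞` and NO Runge certificate exists for `P` (it is «not Runge-certifiable» in the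
sense of RULE K-R49 (ii)).  The `x`-discriminant `−4·A·B` is, however, ℚ-REDUCIBLE of square type: the level
equation `p²·F_Q(u,d) + q(2p+q)·F_A(u,d) = 0` (`r = u/d`, `q = 2^{N!}`, `gcd(p, q(2p+q)) = 1`) forces
`F_A = a·p²`, `F_Q = −a·q·(2p+q)`, and for the family below the twist class `a` is killed 2- and 3-adically
(`a ≡ −1 mod 8`, `supp a ⊆ {3}`, `a = −g²` with `g ∣ λ`): every level point LIFTS to a rational point
`(r, Z₁/d², Z₂/d²)` of the double cover `C' : z₁² = −A(Y), z₂² = B(Y)` with `Z₁ = g·p`, `Z₂ = g·(p+q)`,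
`Z₂ − Z₁ = g·q ≡ 0 mod 2^{N!}`.  Over `x = ∞` the cover SPLITS the orbit in two (`z₂ = ± z₁` at `Q(β) = 0`), and
2-adic RUNGE on `C'` applies: an INTEGRAL DESCENT CERTIFICATE (`Rz² + D²A = Q³U₁`, `Sz² − D²B = Q³U₂`,
`Rz = D·λ·Y³ + Q·V`, `Sz = Rz + Q·W`, `D²F₀ + D·F₁·Rz + D·F₂·Sz + F₃·Rz·Sz = Q³·Ω₁`, `deg F₀ ≤ 5`, `deg F₁, F₂ ≤ 3`,
`deg F₃ ≤ 1`) gives an integer `I = D²·d⁵·Φ(r, Z₁/d², Z₂/d²)` with `‖I‖₂ ≤ (2/‖D‖₂)·2^{−3·N!}` and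
`I² ≤ K·2^{5·N!}`, so `I = 0` for `N ≥ N₀(C)`; then `r` is a root of the NORM `ν = g₀² − B·g₁² ≠ 0` of `Φ`:
finitely many `r`, finitely many levels (`LevelFinite P`, hence `ThinFibreAt m₀ P` for EVERY `m₀`).
NO Diophantine input (no Ridout / Subspace / Thue–Mahler / Faltings), NO binder.

Headlines: `levelFinite_of_descentCert : DescentCert Q A → LevelFinite (dsP Q A)` (THE ENGINE; `descent` = THE
DESCENT LEMMA, `twist_kill` = the twist-killing), the infinite class `DJ λ`, `λ = 3^j` (`j : ℕ`):
`DJ λ = x²·Q + (2x+1)·A_λ`, `Q = Y⁴ + 3Y³ + 3Y² + 3` (Eisenstein at 3, a simple root in `ℚ₂`, no rational root),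
`A_λ = −λ²·ρ`, `ρ = −9Y³ − 21Y² + 9Y − 18 ≡ Y⁶ mod Q`, with ONE certificate `djCert j` POLYNOMIAL IN `λ`;
`levelFinite_DJ : ∀ j, LevelFinite (DJ 3^j)` and `thinFibreAt_DJ : ∀ j m₀, ThinFibreAt m₀ (DJ 3^j)` HYPOTHESIS-FREE;
`DJ_injective` (the class is infinite), named members `DJ1 DJ3 DJ9`; territory `DJ_territory` (§11, tree names).
RUNG 0: nothing here proves `ThinFibre 2`, 33364, 31077, 33363, 31987 or Schanuel; no binder is discharged in general.
-/

noncomputable section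

namespace Summit.Schanuel.Schanuel.Theorems.RootDecomp1KDescent

open Polynomial LiouvilleNumber
open scoped Nat
open Summit.Schanuel.Schanuel.Theorems.RootDecomp1KTwoBaseCell (psNumer partialSum_eq_psNumer_div coprime_psNumer)
open Summit.Schanuel.Schanuel.Theorems.RootDecomp1KRelLiouvilleCell (partialSum_two_strictMono)
open Summit.Schanuel.Schanuel.Theorems.RootDecomp1KDegreeLadder
open Summit.Schanuel.Schanuel.Theorems.RootDecomp1KXLinear
open Summit.Schanuel.Schanuel.Theorems.RootDecomp1KXLinearII
open Summit.Schanuel.Schanuel.Theorems.RootDecomp1KXTop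
open Summit.Schanuel.Schanuel.Theorems.RootDecomp1KXAll
open Summit.Schanuel.Schanuel.Theorems.RootDecomp1KLevelFinite
open Summit.Schanuel.Schanuel.Theorems.RootDecomp1KThueMahler
open Summit.Schanuel.Schanuel.Theorems.RootDecomp1KParamThueMahler
open Summit.Schanuel.Schanuel.Theorems.RootDecomp1KLocalExponent
open Summit.Schanuel.Schanuel.Theorems.RootDecomp1KRunge

/-! ### §0 Small facts -/

/-- `‖(z : ℂ₂)‖ ≤ 1` for integers. -/
private theorem norm_intCast_le_one_ds (z : ℤ) : ‖(z : PadicAlgCl 2)‖ ≤ 1 := by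
  have h1 : (z : PadicAlgCl 2) = algebraMap ℚ_[2] (PadicAlgCl 2) (z : ℚ_[2]) := (map_intCast _ z).symm
  rw [h1, PadicAlgCl.norm_extends]
  exact Padic.norm_int_le_one z

/-- `0 < ‖(m : ℂ₂)‖` for `m ≠ 0`. -/
theorem norm_intCast_pos_ds {m : ℤ} (hm : m ≠ 0) : 0 < ‖(m : PadicAlgCl 2)‖ :=
  norm_pos_iff.mpr (by exact_mod_cast hm)

/-- `‖F(y)‖₂ ≤ 1` for `F ∈ ℤ[Y]` and `‖y‖₂ ≤ 1`. -/
theorem norm_aeval_le_one_ds (F : ℤ[X]) {y : PadicAlgCl 2} (hy : ‖y‖ ≤ 1) : ‖aeval y F‖ ≤ 1 := by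
  have := norm_aeval_le F y
  rwa [max_eq_left hy, one_pow] at this

/-- `num r ⊥ den r`. -/
private theorem isCoprime_num_den_ds (r : ℚ) : IsCoprime r.num (r.den : ℤ) := by
  rw [Int.isCoprime_iff_gcd_eq_one]
  have := r.reduced
  simpa [Int.gcd] using this

/-- `p_N` is odd (`N ≥ 2`). -/
private theorem odd_psNumer_ds {N : ℕ} (hN : 2 ≤ N) : Odd ((psNumer 2 N : ℕ) : ℤ) := by
  have h := coprime_psNumer 2 hN
  have h2 : ¬ 2 ∣ psNumer 2 N := by
    intro hd
    have := Nat.Coprime.eq_one_of_dvd (Nat.Coprime.symm h) hd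
    omega
  rw [Int.odd_iff]
  omega

/-- `8 ∣ n² − 1` for odd `n`. -/
private theorem eight_dvd_sq_sub_one_ds {n : ℤ} (hn : Odd n) : (8 : ℤ) ∣ n ^ 2 - 1 := by
  obtain ⟨k, rfl⟩ := hn
  have h2 : (2 : ℤ) ∣ k * (k + 1) := by
    rcases Int.even_or_odd k with ⟨m, hm⟩ | ⟨m, hm⟩
    · exact ⟨m * (k + 1), by rw [hm]; ring⟩
    · exact ⟨k * (m + 1), by rw [hm]; ring⟩
  obtain ⟨c, hc⟩ := h2
  exact ⟨c, by linear_combination 4 * hc⟩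

/-! ### §1 The curves `P = Q(Y)·x² + A(Y)·(2x+1)` -/

/-- the `x`-coefficients: `c₂ = Q`, `c₁ = 2A`, `c₀ = A`. -/
def dsC (Q A : ℤ[X]) : ℕ → ℤ[X] := fun j =>
  if j = 2 then Q else if j = 1 then 2 * A else if j = 0 then A else 0

/-- the curve `P = x²·Q(Y) + x·2A(Y) + A(Y)`. -/
def dsP (Q A : ℤ[X]) : ℤ[X][X] := xPolyP 2 (dsC Q A)

/-- `(Q A : ℤ[X]) : dsC Q A 2 = Q`. -/
@[simp] theorem dsC_two (Q A : ℤ[X]) : dsC Q A 2 = Q := by simp [dsC]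
/-- `(Q A : ℤ[X]) : dsC Q A 1 = 2 * A`. -/
@[simp] theorem dsC_one (Q A : ℤ[X]) : dsC Q A 1 = 2 * A := by simp [dsC]
/-- `(Q A : ℤ[X]) : dsC Q A 0 = A`. -/
@[simp] theorem dsC_zero (Q A : ℤ[X]) : dsC Q A 0 = A := by simp [dsC]
/-- `(Q A : ℤ[X]) {j : ℕ} (hj : 2 < j) : dsC Q A j = 0`. -/
theorem dsC_of_gt (Q A : ℤ[X]) {j : ℕ} (hj : 2 < j) : dsC Q A j = 0 := by
  simp [dsC, show j ≠ 2 by omega, show j ≠ 1 by omega, show j ≠ 0 by omega]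

/-- `P(x, y) = x²·Q(y) + (2x + 1)·A(y)`. -/
theorem bev_dsP (Q A : ℤ[X]) (x y : ℝ) :
    bev (dsP Q A) x y = x ^ 2 * aeval y Q + (2 * x + 1) * aeval y A := by
  rw [dsP, bev_xPolyP]
  have h2 : (aeval y (2 : ℤ[X])) = (2 : ℝ) := by
    rw [show (2 : ℤ[X]) = C 2 from rfl, aeval_C]; simp
  simp [Finset.sum_range_succ, dsC, h2]
  ring

/-! ### §2 The level equation in integers: `p²·F_Q + q(2p+q)·F_A = 0` -/

/-- the binary form of `F ∈ ℤ[Y]` padded to degree `n`, at `(num r, den r)`. -/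
def hf (F : ℤ[X]) (n : ℕ) (r : ℚ) : ℤ := hform F.coeff n r.num (r.den : ℤ)

/-- `hf F n r = den(r)ⁿ · F(r)` in `ℚ`. -/
theorem hf_cast {F : ℤ[X]} {n : ℕ} (hF : F.natDegree ≤ n) (r : ℚ) :
    ((hf F n r : ℤ) : ℚ) = (r.den : ℚ) ^ n * aeval r F := hform_num_den F hF r

/-- a level point `P(s_N, r) = 0`, read in `ℚ`: `(p/q)²·Q(r) + (2p/q + 1)·A(r) = 0`. -/
theorem level_eq_rat {Q A : ℤ[X]} {N : ℕ} {r : ℚ} (h : bev (dsP Q A) (partialSum 2 N) r = 0) :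
    ((psNumer 2 N : ℚ) / 2 ^ N !) ^ 2 * aeval r Q + (2 * ((psNumer 2 N : ℚ) / 2 ^ N !) + 1) * aeval r A = 0 := by
  rw [bev_dsP, partialSum_two_eq_ratCast, ← aeval_ratCast Q r, ← aeval_ratCast A r] at h
  have h' : (((((psNumer 2 N : ℚ) / 2 ^ N !) ^ 2 * aeval r Q +
      (2 * ((psNumer 2 N : ℚ) / 2 ^ N !) + 1) * aeval r A : ℚ)) : ℝ) = 0 := by
    push_cast at h ⊢; exact h
  exact_mod_cast h'

/-- **the level equation in integers**: `p²·F_Q + q·(2p + q)·F_A = 0` with `F_X = den(r)⁴·X(r)` (`deg A ≤ 4`). -/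
theorem level_eq_int {Q A : ℤ[X]} (hQ : Q.natDegree ≤ 4) (hA : A.natDegree ≤ 4) {N : ℕ} {r : ℚ}
    (h : bev (dsP Q A) (partialSum 2 N) r = 0) :
    ((psNumer 2 N : ℕ) : ℤ) ^ 2 * hf Q 4 r +
      (2 : ℤ) ^ N ! * (2 * ((psNumer 2 N : ℕ) : ℤ) + (2 : ℤ) ^ N !) * hf A 4 r = 0 := by
  have h1 := level_eq_rat h
  have hq : (2 : ℚ) ^ N ! ≠ 0 := pow_ne_zero _ two_ne_zero
  have hd : (r.den : ℚ) ≠ 0 := by exact_mod_cast r.den_nz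
  have key : (((((psNumer 2 N : ℕ) : ℤ) ^ 2 * hf Q 4 r +
      (2 : ℤ) ^ N ! * (2 * ((psNumer 2 N : ℕ) : ℤ) + (2 : ℤ) ^ N !) * hf A 4 r : ℤ)) : ℚ) =
      ((2 : ℚ) ^ N !) ^ 2 * (r.den : ℚ) ^ 4 *
        (((psNumer 2 N : ℚ) / 2 ^ N !) ^ 2 * aeval r Q + (2 * ((psNumer 2 N : ℚ) / 2 ^ N !) + 1) * aeval r A) := by
    push_cast
    rw [hf_cast hQ, hf_cast hA]
    field_simp
  rw [h1, mul_zero] at key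
  exact_mod_cast key

/-! ### §3 The shape of `F_Q` for an Eisenstein quartic, and the homogenised `Y⁶`-identity -/

/-- [datum] the EISENSTEIN SHAPE of the top: `Q = Y⁴ + q₃Y³ + q₂Y² + q₁Y + 3` with `3 ∣ q₁, q₂, q₃`. -/
structure EisQ (Q : ℤ[X]) : Type where
  deg : Q.natDegree = 4
  lead : Q.coeff 4 = 1
  c0 : Q.coeff 0 = 3
  c1 : (3 : ℤ) ∣ Q.coeff 1
  c2 : (3 : ℤ) ∣ Q.coeff 2
  c3 : (3 : ℤ) ∣ Q.coeff 3

/-- `F_Q(u, d) = u⁴ + q₃u³d + q₂u²d² + q₁ud³ + 3d⁴`. -/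
theorem hf_Q_expand {Q : ℤ[X]} (hQ : EisQ Q) (r : ℚ) :
    hf Q 4 r = r.num ^ 4 + Q.coeff 3 * r.num ^ 3 * r.den + Q.coeff 2 * r.num ^ 2 * r.den ^ 2 +
      Q.coeff 1 * r.num * r.den ^ 3 + 3 * (r.den : ℤ) ^ 4 := by
  rw [hf, hform, Finset.sum_range_succ, Finset.sum_range_succ, Finset.sum_range_succ, Finset.sum_range_succ,
    Finset.sum_range_succ, Finset.sum_range_zero, hQ.lead, hQ.c0]
  push_cast
  ring

/-- the homogenised identity: from `A + λ²·Y⁶ = λ²·Q·T` (`deg A ≤ 4`, `deg T ≤ 2`, `deg Q ≤ 4`):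
`d²·F_A + λ²·u⁶ = λ²·F_Q·F_T`. -/
theorem hom_identity {Q A T : ℤ[X]} {l : ℤ} (hQ : Q.natDegree ≤ 4) (hA : A.natDegree ≤ 4) (hT : T.natDegree ≤ 2)
    (hid : A + (l : ℤ[X]) ^ 2 * X ^ 6 = (l : ℤ[X]) ^ 2 * Q * T) (r : ℚ) :
    (r.den : ℤ) ^ 2 * hf A 4 r + l ^ 2 * r.num ^ 6 = l ^ 2 * hf Q 4 r * hf T 2 r := by
  have hev := congrArg (aeval r) hid
  simp only [map_add, map_mul, map_pow, map_intCast, aeval_X] at hev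
  have hd : (r.den : ℚ) ≠ 0 := by exact_mod_cast r.den_nz
  have key : ((((r.den : ℤ) ^ 2 * hf A 4 r + l ^ 2 * r.num ^ 6 : ℤ)) : ℚ) =
      ((l ^ 2 * hf Q 4 r * hf T 2 r : ℤ) : ℚ) := by
    push_cast
    rw [hf_cast hQ, hf_cast hA, hf_cast hT]
    have hr : (r.num : ℚ) = r * r.den := (Rat.mul_den_eq_num r).symm
    have e1 : (r.den : ℚ) ^ 2 * ((r.den : ℚ) ^ 4 * aeval r A) + (l : ℚ) ^ 2 * (r.num : ℚ) ^ 6 =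
        (r.den : ℚ) ^ 6 * (aeval r A + (l : ℚ) ^ 2 * r ^ 6) := by rw [hr]; ring
    rw [e1, hev]; ring
  exact_mod_cast key

/-! ### §4 THE DESCENT LEMMA: the twist class dies 2- and 3-adically -/

/-- `9^w ≡ 1 mod 8`. -/
theorem nine_pow_mod_eight (w : ℕ) : ((9 : ℤ) ^ w) % 8 = 1 := by
  induction w with
  | zero => norm_num
  | succ n ih => rw [pow_succ, Int.mul_emod, ih]; norm_num

/-- an odd power of three: `Odd (3^j)`. -/
private theorem odd_three_pow (j : ℕ) : Odd ((3 : ℤ) ^ j) := Odd.pow (by decide)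

/-- two integers with a common divisor `x` that are coprime: `x = ±1`. -/
theorem eq_one_of_dvd_coprime {u d x : ℤ} (hcop : IsCoprime u d) (hu : x ∣ u) (hd : x ∣ d) (hx : 0 ≤ x) : x = 1 := by
  rcases Int.isUnit_iff.mp (hcop.isUnit_of_dvd' hu hd) with h | h
  · exact h
  · omega

/-- TWIST-KILLING, the 2-adic half: with `d, p, λ, u` odd and `8 ∣ F_Q`, the identity
`(dp)²·a + (λu³)² = λ²·F_Q·F_T` forces `a ≡ −1 (mod 8)`. -/
theorem twist_mod_eight {a d p l u FQ FT : ℤ} (hd : Odd d) (hp : Odd p) (hl : Odd l) (hu : Odd u)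
    (h8 : (8 : ℤ) ∣ FQ) (hid : (d * p) ^ 2 * a + (l * u ^ 3) ^ 2 = l ^ 2 * FQ * FT) : (8 : ℤ) ∣ a + 1 := by
  have hsum : (8 : ℤ) ∣ (d * p) ^ 2 * a + (l * u ^ 3) ^ 2 := by
    rw [hid]; exact (h8.mul_left _).mul_right _
  have e1 := eight_dvd_sq_sub_one_ds (hd.mul hp)
  have e2 : (8 : ℤ) ∣ (l * u ^ 3) ^ 2 - 1 := eight_dvd_sq_sub_one_ds (hl.mul (hu.pow (n := 3)))
  have : a + 1 = ((d * p) ^ 2 * a + (l * u ^ 3) ^ 2) - a * ((d * p) ^ 2 - 1) - ((l * u ^ 3) ^ 2 - 1) := by ring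
  rw [this]; exact (hsum.sub (e1.mul_left a)).sub e2

/-- TWIST-KILLING, the support: `a ∣ F_Q`, `a ∣ λ²u⁶` (`λ = 3^j`), `u ⊥ d` and `F_Q ≡ 3d⁴ (mod u)` force every
prime of `a` to be `3`. -/
theorem twist_support {a l u d FQ q₁ q₂ q₃ : ℤ} {j : ℕ} (hl : l = 3 ^ j) (hcop : IsCoprime u d)
    (hFQ : FQ = u ^ 4 + q₃ * u ^ 3 * d + q₂ * u ^ 2 * d ^ 2 + q₁ * u * d ^ 3 + 3 * d ^ 4) (haFQ : a ∣ FQ)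
    (halu : a ∣ l ^ 2 * u ^ 6) : ∀ {ℓ : ℕ}, ℓ.Prime → ℓ ∣ a.natAbs → ℓ = 3 := by
  intro ℓ hℓ hℓa
  have hℓZ : Prime (ℓ : ℤ) := Nat.prime_iff_prime_int.mp hℓ
  have hℓa' : (ℓ : ℤ) ∣ a := Int.natCast_dvd.mpr hℓa
  have h3 : (ℓ : ℤ) ∣ 3 → ℓ = 3 := fun h =>
    (Nat.prime_dvd_prime_iff_eq hℓ Nat.prime_three).mp (Int.natCast_dvd_natCast.mp h)
  rcases hℓZ.dvd_or_dvd (dvd_trans hℓa' halu) with h | h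
  · apply h3
    have h' : (ℓ : ℤ) ∣ l := hℓZ.dvd_of_dvd_pow h
    rw [hl] at h'
    exact hℓZ.dvd_of_dvd_pow h'
  · have hℓu : (ℓ : ℤ) ∣ u := hℓZ.dvd_of_dvd_pow h
    have h3d : (ℓ : ℤ) ∣ 3 * d ^ 4 := by
      have : 3 * d ^ 4 = FQ - u * (u ^ 3 + q₃ * u ^ 2 * d + q₂ * u * d ^ 2 + q₁ * d ^ 3) := by rw [hFQ]; ring
      rw [this]; exact (dvd_trans hℓa' haFQ).sub (hℓu.mul_right _)
    rcases hℓZ.dvd_or_dvd h3d with h' | h'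
    · exact h3 h'
    · exfalso
      have := eq_one_of_dvd_coprime hcop hℓu (hℓZ.dvd_of_dvd_pow h') (by positivity)
      exact hℓ.one_lt.ne' (by exact_mod_cast this)

/-- TWIST-KILLING, conclusion: `a ≠ 0`, `a ≡ −1 (mod 8)` and `supp a ⊆ {3}` force `a = −9^w`
(`−3^{odd} ≡ −3`, `+3^v ≡ 1, 3 (mod 8)` are excluded). -/
theorem twist_kill {a : ℤ} (ha0 : a ≠ 0) (h8a : (8 : ℤ) ∣ a + 1)
    (hsupp : ∀ {ℓ : ℕ}, ℓ.Prime → ℓ ∣ a.natAbs → ℓ = 3) : ∃ w : ℕ, a = -(9 : ℤ) ^ w := by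
  obtain ⟨v, hav⟩ : ∃ v : ℕ, a.natAbs = 3 ^ v :=
    ⟨_, Nat.eq_prime_pow_of_unique_prime_dvd (Int.natAbs_ne_zero.mpr ha0) hsupp⟩
  have h9 := fun w : ℕ => nine_pow_mod_eight w
  rcases Nat.even_or_odd v with ⟨w, hw⟩ | ⟨w, hw⟩
  · refine ⟨w, ?_⟩
    have h3v : ((a.natAbs : ℕ) : ℤ) = 9 ^ w := by
      rw [hav, hw, ← two_mul, pow_mul]; norm_num
    have := h9 w
    rcases Int.natAbs_eq a with h | h <;> rw [h3v] at h <;> omega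
  · exfalso
    have h3v : ((a.natAbs : ℕ) : ℤ) = 3 * 9 ^ w := by
      rw [hav, hw, pow_succ, pow_mul]; push_cast; ring
    have := h9 w
    rcases Int.natAbs_eq a with h | h <;> rw [h3v] at h <;> omega

/-- TWIST-KILLING, the 3-adic exponent: `a = −9^w` with `a ∣ F_Q`, `a ∣ λ²u⁶`, `3 ∣ q₁` gives `w ≤ j`
(if `3 ∣ u` then `9 ∤ F_Q ≡ 3d⁴`, so `w = 0`; else `9^w ∣ λ² = 9^j`). -/
theorem twist_le {a l u d FQ q₁ q₂ q₃ : ℤ} {j w : ℕ} (hl : l = 3 ^ j) (hcop : IsCoprime u d)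
    (hFQ : FQ = u ^ 4 + q₃ * u ^ 3 * d + q₂ * u ^ 2 * d ^ 2 + q₁ * u * d ^ 3 + 3 * d ^ 4) (h₁ : (3 : ℤ) ∣ q₁)
    (haFQ : a ∣ FQ) (halu : a ∣ l ^ 2 * u ^ 6) (hw : a = -(9 : ℤ) ^ w) : w ≤ j := by
  by_cases h3u : (3 : ℤ) ∣ u
  · suffices w = 0 by omega
    by_contra hw0
    have h9a : (9 : ℤ) ∣ a := by
      obtain ⟨w', rfl⟩ : ∃ w', w = w' + 1 := ⟨w - 1, by omega⟩
      exact ⟨-(9 : ℤ) ^ w', by rw [hw, pow_succ]; ring⟩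
    have h9FQ : (9 : ℤ) ∣ FQ := dvd_trans h9a haFQ
    have h3d : ¬ (3 : ℤ) ∣ d := fun h3d => by
      have := eq_one_of_dvd_coprime hcop h3u h3d (by norm_num); norm_num at this
    have h9' : (9 : ℤ) ∣ 3 * d ^ 4 := by
      have : 3 * d ^ 4 = FQ - u ^ 2 * (u ^ 2 + q₃ * u * d + q₂ * d ^ 2) - q₁ * u * d ^ 3 := by rw [hFQ]; ring
      rw [this]
      refine (h9FQ.sub ?_).sub ?_
      · exact Dvd.dvd.mul_right (by rw [show (9:ℤ) = 3 ^ 2 by norm_num]; exact pow_dvd_pow_of_dvd h3u 2) _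
      · rw [show (9 : ℤ) = 3 * 3 by norm_num, mul_assoc q₁]
        exact mul_dvd_mul h₁ (h3u.mul_right _)
    have h3d4 : (3 : ℤ) ∣ d ^ 4 := by
      have : (3 * 3 : ℤ) ∣ 3 * d ^ 4 := by simpa using h9'
      exact (mul_dvd_mul_iff_left (by norm_num : (3:ℤ) ≠ 0)).mp this
    exact h3d (Int.prime_three.dvd_of_dvd_pow h3d4)
  · have hc3 : IsCoprime (3 : ℤ) u := (Prime.coprime_iff_not_dvd Int.prime_three).mpr h3u
    have hcv : IsCoprime ((3 : ℤ) ^ (2 * w)) (u ^ 6) := hc3.pow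
    have h3vdvd : (3 : ℤ) ^ (2 * w) ∣ l ^ 2 * u ^ 6 := by
      have : (3 : ℤ) ^ (2 * w) = -a := by rw [hw, pow_mul]; norm_num
      rw [this]; exact (neg_dvd).mpr halu
    have h3vl : (3 : ℤ) ^ (2 * w) ∣ l ^ 2 := hcv.dvd_of_dvd_mul_right h3vdvd
    rw [hl, ← pow_mul] at h3vl
    have : 2 * w ≤ j * 2 := by
      have h' : (3 : ℕ) ^ (2 * w) ∣ 3 ^ (j * 2) := by exact_mod_cast h3vl
      exact (Nat.pow_dvd_pow_iff_le_right (by norm_num)).mp h'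
    omega

/-- THE DESCENT LEMMA. A level point of `Q·x² + A·(2x+1)` at `x = p/q` (`q = 2^e`, `e ≥ 3`, `p` odd), written
in the integral forms `F_Q = den⁴·Q(r)`, `F_A = den⁴·A(r)` (`r = u/d`), with `Q` an Eisenstein-at-3 monic quartic
with `Q(0) = 3` and `A ≡ −λ²Y⁶ (mod λ²Q)` (`λ = 3^j`), LIFTS: `F_A = −(g·p)²`, `F_Q = g²·q(2p+q)` with `0 < g ∣ λ`,
and `u`, `d` are odd. (Chevalley–Weil for the étale double cover `z₁² = −A`, `z₂² = Q − A`: the twist class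
`a` of the lift satisfies `a ≡ −1 (mod 8)` and `supp a ⊆ {3}`, hence `a = −g²`.) -/
theorem descent {p q l u d FQ FA FT q₁ q₂ q₃ : ℤ} {e j : ℕ} (hq : q = 2 ^ e) (he : 3 ≤ e) (hl : l = 3 ^ j)
    (hp : Odd p) (hp0 : 0 < p) (hcop : IsCoprime u d)
    (hFQ : FQ = u ^ 4 + q₃ * u ^ 3 * d + q₂ * u ^ 2 * d ^ 2 + q₁ * u * d ^ 3 + 3 * d ^ 4) (h₁ : (3 : ℤ) ∣ q₁)
    (hlev : p ^ 2 * FQ + q * (2 * p + q) * FA = 0) (hT : d ^ 2 * FA + l ^ 2 * u ^ 6 = l ^ 2 * FQ * FT) :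
    ∃ g : ℤ, 0 < g ∧ g ∣ l ∧ FA = -(g * p) ^ 2 ∧ FQ = g ^ 2 * (q * (2 * p + q)) ∧ Odd u ∧ Odd d := by
  -- (0) `q`
  have hq8 : (8 : ℤ) ∣ q := by
    rw [hq, show e = 3 + (e - 3) by omega, pow_add]; exact Dvd.intro _ rfl
  have hq2 : (2 : ℤ) ∣ q := dvd_trans (by norm_num) hq8
  -- (1) `p² ⊥ q(2p+q)` and the twist class `a`: `F_A = p²·a`, `F_Q = −a·q(2p+q)`
  have hp2 : IsCoprime p 2 := by
    obtain ⟨k, hk⟩ := hp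
    exact ⟨1, -k, by rw [hk]; ring⟩
  have hpq : IsCoprime p q := by rw [hq]; exact hp2.pow_right
  have hp2q : IsCoprime p (2 * p + q) := by
    have := hpq.add_mul_left_right 2
    rwa [show q + p * 2 = 2 * p + q by ring] at this
  have hcop2 : IsCoprime (p ^ 2) (q * (2 * p + q)) := (hpq.mul_right hp2q).pow_left
  have hdvd : p ^ 2 ∣ q * (2 * p + q) * FA := ⟨-FQ, by linear_combination hlev⟩
  obtain ⟨a, ha⟩ := hcop2.dvd_of_dvd_mul_left hdvd
  have hFQa : FQ = -a * (q * (2 * p + q)) := by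
    have hp2ne : p ^ 2 ≠ 0 := pow_ne_zero 2 hp0.ne'
    apply mul_left_cancel₀ hp2ne
    linear_combination hlev - q * (2 * p + q) * ha
  have hevFQ : Even FQ := by
    obtain ⟨c, hc⟩ := hq2
    exact ⟨-a * (c * (2 * p + q)), by rw [hFQa, hc]; ring⟩
  -- (2) `d` odd, then `u` odd
  have hdodd : Odd d := by
    by_contra hd
    rw [Int.not_odd_iff_even] at hd
    have hu : Odd u := by
      by_contra hu
      rw [Int.not_odd_iff_even] at hu
      have h1 := eq_one_of_dvd_coprime hcop (even_iff_two_dvd.mp hu) (even_iff_two_dvd.mp hd) (by norm_num)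
      norm_num at h1
    have hodd : Odd FQ := by
      rw [hFQ, show u ^ 4 + q₃ * u ^ 3 * d + q₂ * u ^ 2 * d ^ 2 + q₁ * u * d ^ 3 + 3 * d ^ 4 =
        u ^ 4 + d * (q₃ * u ^ 3 + q₂ * u ^ 2 * d + q₁ * u * d ^ 2 + 3 * d ^ 3) by ring]
      exact (hu.pow).add_even (hd.mul_right _)
    exact (Int.not_even_iff_odd.mpr hodd) hevFQ
  have huodd : Odd u := by
    by_contra hu
    rw [Int.not_odd_iff_even] at hu
    have hodd : Odd FQ := by
      rw [hFQ, show u ^ 4 + q₃ * u ^ 3 * d + q₂ * u ^ 2 * d ^ 2 + q₁ * u * d ^ 3 + 3 * d ^ 4 =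
        u * (u ^ 3 + q₃ * u ^ 2 * d + q₂ * u * d ^ 2 + q₁ * d ^ 3) + 3 * d ^ 4 by ring]
      exact (hu.mul_right _).add_odd ((show Odd (3 : ℤ) by decide).mul hdodd.pow)
    exact (Int.not_even_iff_odd.mpr hodd) hevFQ
  -- (3) `a ≡ −1 mod 8`
  have hlodd : Odd l := by rw [hl]; exact odd_three_pow j
  have h8FQ : (8 : ℤ) ∣ FQ := by rw [hFQa]; exact (hq8.mul_right _).mul_left _
  have hid : (d * p) ^ 2 * a + (l * u ^ 3) ^ 2 = l ^ 2 * FQ * FT := by rw [← hT, ha]; ring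
  have h8a : (8 : ℤ) ∣ a + 1 := twist_mod_eight hdodd hp hlodd huodd h8FQ hid
  have ha0 : a ≠ 0 := by rintro rfl; norm_num at h8a
  -- (4) `supp a ⊆ {3}`, so `a = −9^w`, and `w ≤ j`
  have haFQ : a ∣ FQ := ⟨-(q * (2 * p + q)), by rw [hFQa]; ring⟩
  have halu : a ∣ l ^ 2 * u ^ 6 := by
    have : l ^ 2 * u ^ 6 = l ^ 2 * FQ * FT - d ^ 2 * FA := by linear_combination hT
    rw [this, ha]
    exact (Dvd.dvd.mul_left haFQ _ |>.mul_right _).sub (Dvd.intro (d ^ 2 * p ^ 2) (by ring))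
  obtain ⟨w, hw⟩ := twist_kill ha0 h8a (twist_support hl hcop hFQ haFQ halu)
  have hwj : w ≤ j := twist_le hl hcop hFQ h₁ haFQ halu hw
  -- (5) conclusion
  refine ⟨3 ^ w, by positivity, ?_, ?_, ?_, huodd, hdodd⟩
  · rw [hl]; exact pow_dvd_pow 3 hwj
  · rw [ha, hw, show (9 : ℤ) = 3 ^ 2 by norm_num, ← pow_mul]; ring
  · rw [hFQa, hw, show (9 : ℤ) = 3 ^ 2 by norm_num, ← pow_mul]; ring

end Summit.Schanuel.Schanuel.Theorems.RootDecomp1KDescent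

end
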